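import Summits.KontsevichZagierPeriods.KontsevichZagierPeriods.Theses.HermiteRigidity
import Summits.KontsevichZagierPeriods.KontsevichZagierPeriods.Theses.SymplecticScissors
import Summits.KontsevichZagierPeriods.KontsevichZagierPeriods.Theorems.HermiteRigidityReductionRigidityFrame

/-!
# Line skeleton v3 — crux `ReductionRigidity` (stmt-KontsevichZagierPeriods-3407), line `SketchIdeator2` (idea `compact-volume-basis`)

Lead prover `prover-line-stmt-KontsevichZagierPeriods-3407-c1-0`, 2026-08-16 (continuation of leads
`…-3407-0` / `…-3407-1`; same line, same single stub). v3 differs from v2 (sha 3b837d71…) only in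
that the glue, landed meanwhile as `Theorems/HermiteRigidityReductionRigidityFrame.lean` (p87406,
`reductionRigidity_of_volumeForm : VolumeForm → ReductionRigidity`), is now IMPORTED instead of
re-proved inline.

The crux (REDUCTION + RIGIDITY) is kernel-checked EQUIVALENT TO THE SUMMIT
(`reductionRigidity_iff_kontsevichZagierPeriods`) and to the shared volume frame `VolumeForm`
(stmt-KontsevichZagierPeriods-3814, `reductionRigidity_iff_volumeForm`). Hence every line for this
crux has exactly one honest open input and it is summit-strength; this skeleton makes that input the
EXISTING, independently staffed item 3814 verbatim:

* `stub_volumeForm` — THE stub: `Theses.SymplecticScissors.VolumeForm` (= stmt-3814; own crux chain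
  `Cruxes/VolumeForm/`, own line lead).
* `ReductionRigidity_of` — concludes the crux BY NAME from the stub via the landed glue.

When `VolumeForm_holds` lands (item 3814 closed `proved`), the crux closes in one line:
`theorem reductionRigidity_proof : ReductionRigidity := reductionRigidity_of_volumeForm VolumeForm_holds`.
-/

noncomputable section

set_option linter.dupNamespace false

namespace Summit.KontsevichZagierPeriods.KontsevichZagierPeriods.Cruxes.ReductionRigidity.CompactVolumeBasis

open Summit.KontsevichZagierPeriods.KontsevichZagierPeriods.Theses.HermiteRigidity (ReductionRigidity)
open Summit.KontsevichZagierPeriods.KontsevichZagierPeriods.Theses.SymplecticScissors (VolumeForm)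

/-- STUB (the line's single open input; verbatim the shared frame item stmt-KontsevichZagierPeriods-3814):
two integrand-`1` representations of one dimension with equal volume are KZ-equivalent. -/
theorem stub_volumeForm :
    Summit.KontsevichZagierPeriods.KontsevichZagierPeriods.Theses.SymplecticScissors.VolumeForm := by
  sorry

/-- **The composition**: the crux `ReductionRigidity`, concluded BY NAME from the stub through the
landed glue `reductionRigidity_of_volumeForm` (frame ⇒ compact volume form ⇒ Conjecture 1 by
Viu-Sos' semi-canonical reduction ⇒ kernel form ⇒ crux by a Hamel-type choice over `ℚ̄ ∩ ℝ`). -/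
theorem ReductionRigidity_of :
    Summit.KontsevichZagierPeriods.KontsevichZagierPeriods.Theses.HermiteRigidity.ReductionRigidity :=
  Summit.KontsevichZagierPeriods.HermiteRigidity.ReductionRigidity.reductionRigidity_of_volumeForm
    stub_volumeForm

end Summit.KontsevichZagierPeriods.KontsevichZagierPeriods.Cruxes.ReductionRigidity.CompactVolumeBasis

end
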